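import Summits.ResolutionOfSingularities.ResolutionOfSingularities.Theorems.FrobeniusLadderFRationalResolutionUnitBasisEtale
import Summits.ResolutionOfSingularities.ResolutionOfSingularities.Theorems.FrobeniusLadderFRationalResolutionCoarsening
import Mathlib.RingTheory.RingHom.Etale
import Mathlib.RingTheory.RingHom.Finite
import HarnessLib

/-!
# Crux `FrobeniusLadder.FRationalResolution` (stmt-ResolutionOfSingularities-15317), line `redirect`,
# stub `stub_diagonalizableQuotientResolution` — census item R3-tame at the level of the chart ring:
# the inclusion `S₀ ⊆ S^{(B)} = ⊕_{b ∈ B} S_b` of degree-zero parts (grading coarsened along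
# `f : A → A'` with kernel `B`) is FINITE ÉTALE when every `b ∈ B` carries a homogeneous unit and
# `|B|` is invertible

For the quotient chart `Spec S₀`, `S` regular graded by the finite abelian group `A`, and a point
whose unit-degree subgroup is `B` (after inverting one element of `S₀`, every `b ∈ B` carries a
GLOBAL homogeneous unit — `…StabilizerSubgroup`, `…LocalizedUnitsBasis`), the grading coarsened
along `A → A/B` (`…Coarsening.exists_coarsening`) has degree-zero part `S^{(B)} ⊇ S₀`, and the
point is FIXED for it. This file supplies the ring map between the two chart rings and its
properties:

* `exists_ringHom_val_eq` — the inclusion `ι : S₀ → S'₀` of degree-zero parts (`S_a ≤ S'_{f a}`);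
* `isUnit_natCast_gradeZero` — a natural number invertible in `S` is invertible in `S'₀`;
* `exists_ringHom_etale_finite` — **`ι` is finite étale** when every `b ∈ B = ker f` carries a
  homogeneous unit of `S` and `|B| ∈ S^×`: `S'₀` is free over `S₀` on the units `(u_b)_{b ∈ B}`
  (independence by projecting to the `A`-degrees, spanning by the `A`-decomposition), the units
  multiply up to degree-`0` scalars, and `UnitBasisEtale.etale` applies — so
  `Spec S^{(B)} → Spec S₀` is a finite étale cover and `Spec S^{(B)} → Spec S₀ → X` is again an
  étale chart, now through a fixed point of the coarsened grading (tame case `p ∤ |B_𝔔|`).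

Honest label: brick R3-tame, ring level (no stub closed; the scheme-level repackaging under the
stub's `hq` is not here). No definitions, no named facts, no sorry.
[folklore; cite: SGA1, Exp. I Prop. 7.6; SGA3, Exp. VIII §4–5]
-/

noncomputable section

-- single-problem summit: the doubled namespace component is forced
set_option linter.dupNamespace false

open DirectSum

namespace Summit.ResolutionOfSingularities.ResolutionOfSingularities.Theorems.FRationalResolution.CoarseningEtale

universe u v w w'

variable {k : Type u} [CommRing k] {A : Type w} [DecidableEq A] [AddCommGroup A] {S : Type v}
  [CommRing S] [Algebra k S] (𝒮 : A → Submodule k S) [GradedAlgebra 𝒮]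
  {A' : Type w'} [DecidableEq A'] [AddCommGroup A'] (f : A →+ A')
  (𝒮' : A' → Submodule k S) [GradedAlgebra 𝒮']
  (h𝒮' : ∀ c, 𝒮' c = ⨆ a ∈ {a : A | f a = c}, 𝒮 a)
include h𝒮'

omit [DecidableEq A] [GradedAlgebra 𝒮] [DecidableEq A'] [GradedAlgebra 𝒮'] in
/-- `S_a ≤ S'_{f a}` for the coarsened grading. [folklore] -/
theorem le_coarse (a : A) : 𝒮 a ≤ 𝒮' (f a) := by
  rw [h𝒮' (f a)]
  exact le_biSup (fun a => 𝒮 a) (show a ∈ {a' : A | f a' = f a} from rfl)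

omit [DecidableEq A] [GradedAlgebra 𝒮] [DecidableEq A'] [GradedAlgebra 𝒮'] in
/-- `S_a ≤ S'_0` for `a` in the kernel. [folklore] -/
theorem le_coarse_zero {a : A} (ha : f a = 0) : 𝒮 a ≤ 𝒮' 0 := by
  have h := le_coarse 𝒮 f 𝒮' h𝒮' a
  rwa [ha] at h

/-- **The inclusion of degree-zero parts** `ι : S₀ → S'₀`, `S'` the grading coarsened along `f`
(a ring map with `ι x = x` in `S`). [folklore; cite: SGA3, Exp. VIII §4–5] -/
theorem exists_ringHom_val_eq :
    ∃ ι : 𝒮 0 →+* 𝒮' 0, ∀ x, (ι x : S) = x := by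
  have h0 : 𝒮 0 ≤ 𝒮' 0 := le_coarse_zero 𝒮 f 𝒮' h𝒮' (map_zero f)
  exact ⟨{ toFun := fun x => ⟨x.1, h0 x.2⟩
           map_one' := Subtype.ext rfl
           map_mul' := fun x y => Subtype.ext rfl
           map_zero' := Subtype.ext rfl
           map_add' := fun x y => Subtype.ext rfl }, fun x => rfl⟩

omit h𝒮' in
/-- A natural number invertible in `S` is invertible in the degree-zero part `S'₀` (the inverse
of a degree-`0` unit has degree `0`). [folklore] -/
theorem isUnit_natCast_gradeZero (n : ℕ) (hn : IsUnit ((n : ℕ) : S)) : IsUnit ((n : ℕ) : 𝒮' 0) := by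
  obtain ⟨w, hw⟩ := hn.exists_right_inv
  have hwmem : w ∈ 𝒮' 0 := by
    have h := HomogeneousUnits.inv_mem_of_isUnit 𝒮' (SetLike.natCast_mem_graded 𝒮' n) hw
    rwa [neg_zero] at h
  exact IsUnit.of_mul_eq_one ⟨w, hwmem⟩ (Subtype.ext (by simpa using hw))

/-- **R3-tame, ring level: `S₀ → S^{(B)}` is finite étale.** Let `S` be graded by `A`, `S'` the
grading coarsened along `f : A → A'` with kernel `B` (`S'_c = ⨆_{f a = c} S_a`, so
`S'_0 = ⊕_{b ∈ B} S_b ⊇ S_0`). If `B` is finite, every `b ∈ B` carries a homogeneous UNIT of `S`,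
and `|B|` is invertible in `S`, then the inclusion `ι : S_0 → S'_0` is FINITE ÉTALE: `S'_0` is free
over `S_0` on the units, which multiply up to degree-`0` scalars, and Kummer étaleness
(`UnitBasisEtale.etale`) applies. [folklore; cite: SGA1, Exp. I Prop. 7.6; SGA3, Exp. VIII §4–5] -/
theorem exists_ringHom_etale_finite (B : AddSubgroup A) (hker : ∀ a, f a = 0 ↔ a ∈ B) [Finite B]
    (hunits : ∀ b ∈ B, ∃ u ∈ 𝒮 b, IsUnit u) (hcard : IsUnit ((Nat.card B : ℕ) : S)) :
    ∃ ι : 𝒮 0 →+* 𝒮' 0, (∀ x, (ι x : S) = x) ∧ ι.Etale ∧ ι.Finite := by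
  classical
  obtain ⟨ι, hι⟩ := exists_ringHom_val_eq 𝒮 f 𝒮' h𝒮'
  refine ⟨ι, hι, ?_⟩
  letI : Algebra (𝒮 0) (𝒮' 0) := ι.toAlgebra
  have hsmul : ∀ (r : 𝒮 0) (y : 𝒮' 0), ((r • y : 𝒮' 0) : S) = (r : S) * (y : S) := by
    intro r y
    rw [Algebra.smul_def]
    change ((ι r * y : 𝒮' 0) : S) = _
    rw [show ((ι r * y : 𝒮' 0) : S) = (ι r : S) * (y : S) from rfl, hι]
  -- the units and their inverses
  have hmemB : ∀ b : B, f (b : A) = 0 := fun b => (hker b).2 b.2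
  choose u hu huunit using fun b : B => hunits (b : A) b.2
  have hv : ∀ b : B, ∃ v ∈ 𝒮 (-(b : A)), u b * v = 1 := by
    intro b
    obtain ⟨v, hv⟩ := (huunit b).exists_right_inv
    exact ⟨v, HomogeneousUnits.inv_mem_of_isUnit 𝒮 (hu b) hv, hv⟩
  choose v hvmem hv using hv
  -- the candidate basis vectors in `S'_0`
  let e : B → 𝒮' 0 := fun b => ⟨u b, le_coarse_zero 𝒮 f 𝒮' h𝒮' (hmemB b) (hu b)⟩
  have he : ∀ b, (e b : S) = u b := fun b => rfl
  have heunit : ∀ b, IsUnit (e b) := by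
    intro b
    have hvb : v b ∈ 𝒮' 0 :=
      le_coarse_zero 𝒮 f 𝒮' h𝒮' (by rw [map_neg, hmemB, neg_zero]) (hvmem b)
    exact IsUnit.of_mul_eq_one ⟨v b, hvb⟩ (Subtype.ext (by simpa using hv b))
  -- pieces as degree-0 multiples of the units
  have hpiece : ∀ (b : B) (t : S), t ∈ 𝒮 (b : A) → ∃ r ∈ 𝒮 0, t = r * u b := fun b t ht =>
    (HomogeneousUnits.mem_grade_iff_exists_mul_unit 𝒮 (hu b) (hv b) t).mp ht
  -- linear independence: project a relation to the `A`-degrees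
  have hli : LinearIndependent (𝒮 0) e := by
    rw [linearIndependent_iff']
    intro s g hsum b hb
    have hsumS : ∑ c ∈ s, ((g c : S) * u c) = 0 := by
      have h : ((∑ c ∈ s, g c • e c : 𝒮' 0) : S) = 0 :=
        congrArg (fun y : 𝒮' 0 => (y : S)) hsum
      rw [show ((∑ c ∈ s, g c • e c : 𝒮' 0) : S) = ∑ c ∈ s, ((g c • e c : 𝒮' 0) : S) from
        map_sum (algebraMap (𝒮' 0) S) _ _] at h
      simpa only [hsmul, he] using h
    have hcomp : ∀ c ∈ s, (decompose 𝒮 ((g c : S) * u c) (b : A) : S) =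
        if c = b then (g b : S) * u b else 0 := by
      intro c _
      have hmem : (g c : S) * u c ∈ 𝒮 (c : A) := by
        have h := SetLike.mul_mem_graded (g c).2 (hu c)
        rwa [zero_add] at h
      by_cases hcb : c = b
      · subst hcb
        rw [if_pos rfl, decompose_of_mem_same 𝒮 hmem]
      · rw [if_neg hcb, decompose_of_mem_ne 𝒮 hmem (fun h => hcb (Subtype.ext h))]
    have hproj : ∑ c ∈ s, (decompose 𝒮 ((g c : S) * u c) (b : A) : S) = 0 := by
      have h := congrArg (GradedRing.proj 𝒮 (b : A)) hsumS
      rw [map_sum, map_zero] at h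
      simpa only [GradedRing.proj_apply] using h
    rw [Finset.sum_congr rfl hcomp, Finset.sum_ite_eq' s b, if_pos hb] at hproj
    have hgb : (g b : S) = 0 := by
      have h := congrArg (· * v b) hproj
      simpa [mul_assoc, hv b] using h
    exact Subtype.ext hgb
  -- spanning: decompose along `A`; components outside `B` vanish
  have hsp : ⊤ ≤ Submodule.span (𝒮 0) (Set.range e) := by
    rintro x -
    have hxmem : (x : S) ∈ ⨆ a ∈ {a : A | f a = 0}, 𝒮 a := by rw [← h𝒮' 0]; exact x.2
    -- the components, as elements of `S'_0`
    let y : A → 𝒮' 0 := fun a =>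
      if ha : f a = 0 then ⟨(decompose 𝒮 (x : S) a : S), le_coarse_zero 𝒮 f 𝒮' h𝒮' ha
        (decompose 𝒮 (x : S) a).2⟩ else 0
    have hyval : ∀ a, (y a : S) = (decompose 𝒮 (x : S) a : S) := by
      intro a
      by_cases ha : f a = 0
      · simp only [y, dif_pos ha]
      · simp only [y, dif_neg ha]
        rw [Coarsening.decompose_apply_eq_zero_of_mem_biSup 𝒮 hxmem ha]
        rfl
    have hx : x = ∑ a ∈ (decompose 𝒮 (x : S)).support, y a := by
      apply Subtype.ext
      rw [show ((∑ a ∈ (decompose 𝒮 (x : S)).support, y a : 𝒮' 0) : S) =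
          ∑ a ∈ (decompose 𝒮 (x : S)).support, (y a : S) from map_sum (algebraMap (𝒮' 0) S) _ _]
      simp only [hyval]
      exact (sum_support_decompose 𝒮 (x : S)).symm
    rw [hx]
    refine Submodule.sum_mem _ fun a _ => ?_
    by_cases ha : f a = 0
    · have haB : a ∈ B := (hker a).1 ha
      obtain ⟨r, hr, hra⟩ := hpiece ⟨a, haB⟩ _ (decompose 𝒮 (x : S) a).2
      have hya : y a = (⟨r, hr⟩ : 𝒮 0) • e ⟨a, haB⟩ := by
        apply Subtype.ext
        rw [hsmul, he, hyval]
        exact hra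
      rw [hya]
      exact Submodule.smul_mem _ _ (Submodule.subset_span (Set.mem_range_self _))
    · simp only [y, dif_neg ha]
      exact Submodule.zero_mem _
  let basis : Module.Basis B (𝒮 0) (𝒮' 0) := Module.Basis.mk hli hsp
  have hbasis : ∀ b, basis b = e b := fun b => Module.Basis.mk_apply hli hsp b
  -- multiplicativity up to degree-0 scalars
  have hmul : ∀ b b' : B, ∃ r : 𝒮 0, e b * e b' = r • e (b + b') := by
    intro b b'
    have hmem : u b * u b' ∈ 𝒮 ((b + b' : B) : A) := by
      rw [AddSubgroup.coe_add]
      exact SetLike.mul_mem_graded (hu b) (hu b')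
    obtain ⟨r, hr, hrw⟩ := hpiece (b + b') _ hmem
    refine ⟨⟨r, hr⟩, Subtype.ext ?_⟩
    rw [hsmul, he, show ((e b * e b' : 𝒮' 0) : S) = u b * u b' from rfl]
    exact hrw
  have hcard' : IsUnit ((Nat.card B : ℕ) : 𝒮' 0) := isUnit_natCast_gradeZero 𝒮' _ hcard
  constructor
  · -- étale
    show @Algebra.Etale (𝒮 0) (𝒮' 0) _ _ ι.toAlgebra
    exact UnitBasisEtale.etale (fun b => e b) heunit hmul basis hbasis hcard'
  · -- finite
    show @Module.Finite (𝒮 0) (𝒮' 0) _ _ ι.toAlgebra.toModule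
    haveI : Fintype B := Fintype.ofFinite B
    exact Module.Finite.of_basis basis

end Summit.ResolutionOfSingularities.ResolutionOfSingularities.Theorems.FRationalResolution.CoarseningEtale

end
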